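import Literature.MathematicalPhysics.QuantumFieldTheory.BalabanImbrieJaffe1984to88.BIJ88Sect2Statements
import Literature.MathematicalPhysics.QuantumFieldTheory.BalabanImbrieJaffe1984to88.BIJ88Sect4Statements
import Literature.MeasureTheory.Hausdorff.CountableDimensionTest

/-!
# `BalabanImbrieJaffe1984to88.BIJ88ChargePowerLogScale` — T. Bałaban, J. Imbrie, A. Jaffe, *Effective action and cluster
properties of the abelian Higgs model*, Commun. Math. Phys. **114** (1988) 257–315 [BalabanImbrieJaffe1988]:
the mechanism behind the standing *"e ≪ 1"* of p. 273 [PDF 17] (*"we assume that L^kε < ε₀ = min{1, (8λ/e²)^{1/2}}e^β, with β > 0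
small and e ≪ 1"*) against the logarithmic scale **(2.33)** p. 263 *"p(e_k) = |log e_k⁻¹|^p"* at the running charge **(2.2)** p. 260
*"e_k = (L^kε)^{(4−d)/2}e, λ_k = (L^kε)^{4−d}λ"* — PROVED: a positive power of the bare charge `e` absorbs every power of `p(e_k)`
UNIFORMLY in the scale `s = L^kε ∈ (0,1]` (the `log (L^kε)⁻¹` part of `log e_k⁻¹` is absorbed by any positive power of `s`), with an
explicit threshold; plus the (2.2)/(2.33) scale identities and the elementary facts about the printed stopping scale `ε₀` and the
vertex factor `e^β(L^kε/ε₀)^{1/4−α}` (p. 298) used by `BIJ88Passage593Regime` (the pp. 296–297 regime sentence of (5.9.3)).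
SUPPORT FILE (kind «kernel lemma») for row **C2.Eq5.9.3** of `HOME/lit-balaban-r16/ROWS-C2-part2.md`; theorems only.

statement-level skeleton of published theorems with citation tags; proofs where landed; nothing here is a claim about the Yang–Mills mass gap

PDF held: `paper:balaban1988-cmp114-bij-abelian-higgs-effective-action` (journal page = PDF page + 256); (2.2)/(2.3) p. 260 [PDF 4],
(2.33) p. 263 [PDF 7], (4.1) p. 273 [PDF 17], p. 298 [PDF 42] read this session from the text layer.

CITATION HEADER (lean-in-tree rule).  Part of the lit-balaban TYPED SKELETON (HOME `run/shared/lean/pub/lit-balaban/`), Phase 2,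
seat p02 gen 7 (unit `lit-balaban-p02`); support lemmas over r18's definitions `BIJ88Sect2Statements.pLog` (2.33) and
`BIJ88Sect4Statements.eps0` (p. 273, `e^β` read with e = the CHARGE, as typed there; cf. GAPS G-C2-p36-04 on the two typed readings of
the letter e).  WHAT IS PROVED HERE (0 `sorry`, standard axioms, no definitions, no named facts):
* §1 `rpow_mul_abs_log_rpow_le` (`x^γ|log x|^q ≤ (q/γ)^q` on `(0,1]`, from Mathlib's `Real.abs_log_mul_self_rpow_lt`),
  `rpow_mul_log_inv_rpow_le` (`e^θ(log e⁻¹)^q ≤ (2q/θ)^q e^{θ/2}`; the split `(A+B)^q ≤ 2^q(A^q+B^q)` is REUSED from the tree,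
  `Literature.MeasureTheory.Hausdorff.add_rpow_le_two_rpow_mul`), the MASTER
  BOUNDS `logmix_bound` (`K e^θ s^γ (m log s⁻¹ + log e⁻¹)^q ≤ K2^q(m^q(q/γ)^q + (2q/θ)^q)·e^{θ/2}`, uniform in `s ∈ (0,1]`) and
  `logconst_bound`, and the threshold `small_of_le_threshold` (`C e^{θ/2} ≤ ½` for `0 < e ≤ (2C+1)^{−2/θ}`);
* §2 `log_inv_ek` (`log e_k⁻¹ = ((4−d)/2) log (L^kε)⁻¹ + log e⁻¹`), `pLog_pow_three` (`p(e_k)³ = (…)^{3p}`), `lamk_rpow_neg_quarter_eq`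
  (`λ_k^{−1/4} = λ^{−1/4}(L^kε)^{−(4−d)/4}`);
* §3 `eps0_pos`, `eps0_le_rpow` (`ε₀ ≤ e^β`), `vertex_lower` (`e^{β(3/4+α)}s^{1/4−α} ≤ e^β(s/ε₀)^{1/4−α}` for `0 < ε₀ ≤ e^β`, `α ≤ ¼`),
  `vertex_le_one` (`e^β(s/ε₀)^{1/4−α} ≤ 1` for `e ≤ 1`, `β ≥ 0`, `s ≤ ε₀`), `one_le_pLog` (`p(e_k) ≥ 1` once `e_k ≤ 1/e`).
No Summits import.
-/

namespace Literature.MathematicalPhysics.QuantumFieldTheory.BalabanImbrieJaffe1984to88.BIJ88ChargePowerLogScale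

open BIJ88Sect2Statements (pLog)

/-! ## §1 Real-analysis kernels: powers of logarithms against powers -/

section Kernels

/-- `x^γ|log x|^q ≤ (q/γ)^q` on `(0,1]` (γ, q > 0) — from Mathlib's `|log x · x^t| < 1/t`. [cite: BalabanImbrieJaffe1988, (2.33) p.263] -/
theorem rpow_mul_abs_log_rpow_le {x γ q : ℝ} (hx : 0 < x) (hx1 : x ≤ 1) (hγ : 0 < γ) (hq : 0 < q) :
    x ^ γ * |Real.log x| ^ q ≤ (q / γ) ^ q := by
  have ht : 0 < γ / q := div_pos hγ hq
  have h := Real.abs_log_mul_self_rpow_lt x (γ / q) hx hx1 ht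
  have h1 : |Real.log x| * x ^ (γ / q) ≤ q / γ := by
    have : |Real.log x * x ^ (γ / q)| = |Real.log x| * x ^ (γ / q) := by
      rw [abs_mul, abs_of_nonneg (Real.rpow_nonneg hx.le _)]
    rw [← this]; rw [one_div, inv_div] at h; exact h.le
  have h0 : 0 ≤ |Real.log x| * x ^ (γ / q) := mul_nonneg (abs_nonneg _) (Real.rpow_nonneg hx.le _)
  have h2 := Real.rpow_le_rpow h0 h1 hq.le
  rw [Real.mul_rpow (abs_nonneg _) (Real.rpow_nonneg hx.le _), ← Real.rpow_mul hx.le,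
    div_mul_cancel₀ γ hq.ne'] at h2
  linarith [h2]

/-- `e^θ(log e⁻¹)^q ≤ (2q/θ)^q e^{θ/2}` for `0 < e ≤ 1`, `θ, q > 0` — half of the power of `e` absorbs any power of `log e⁻¹`
(the content of *"e ≪ 1"*, p. 273, against the logarithmic scale (2.33)). [cite: BalabanImbrieJaffe1988, (2.33) p.263] -/
theorem rpow_mul_log_inv_rpow_le {e θ q : ℝ} (he : 0 < e) (he1 : e ≤ 1) (hθ : 0 < θ) (hq : 0 < q) :
    e ^ θ * Real.log e⁻¹ ^ q ≤ (2 * q / θ) ^ q * e ^ (θ / 2) := by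
  have hlog : Real.log e⁻¹ = |Real.log e| := by
    rw [Real.log_inv, abs_of_nonpos (Real.log_nonpos he.le he1)]
  have h := rpow_mul_abs_log_rpow_le he he1 (half_pos hθ) hq
  have hsplit : e ^ θ = e ^ (θ / 2) * e ^ (θ / 2) := by
    rw [← Real.rpow_add he]; ring_nf
  rw [hlog, hsplit, mul_assoc, mul_comm]
  have : q / (θ / 2) = 2 * q / θ := by field_simp
  rw [this] at h
  calc e ^ (θ / 2) * |Real.log e| ^ q * e ^ (θ / 2) ≤ (2 * q / θ) ^ q * e ^ (θ / 2) :=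
      mul_le_mul_of_nonneg_right h (Real.rpow_nonneg he.le _)

/-- MASTER BOUND, two logarithms: `K e^θ s^γ (m log s⁻¹ + log e⁻¹)^q ≤ K 2^q (m^q(q/γ)^q + (2q/θ)^q) · e^{θ/2}` for `0 < s ≤ 1`,
`0 < e ≤ 1` (K, m ≥ 0; γ, q, θ > 0) — UNIFORM in `s`: the positive power `s^γ` of the scale absorbs the `log (L^kε)⁻¹` part of
`log e_k⁻¹`. [cite: BalabanImbrieJaffe1988, (5.9.3) p.296] -/
theorem logmix_bound {K γ q m θ s e : ℝ} (hK : 0 ≤ K) (hγ : 0 < γ) (hq : 0 < q) (hm : 0 ≤ m) (hθ : 0 < θ)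
    (hs : 0 < s) (hs1 : s ≤ 1) (he : 0 < e) (he1 : e ≤ 1) :
    K * e ^ θ * s ^ γ * (m * Real.log s⁻¹ + Real.log e⁻¹) ^ q
      ≤ K * 2 ^ q * (m ^ q * (q / γ) ^ q + (2 * q / θ) ^ q) * e ^ (θ / 2) := by
  have hls : 0 ≤ Real.log s⁻¹ := Real.log_nonneg ((one_le_inv₀ hs).mpr hs1)
  have hle : 0 ≤ Real.log e⁻¹ := Real.log_nonneg ((one_le_inv₀ he).mpr he1)
  have hls' : Real.log s⁻¹ = |Real.log s| := by
    rw [Real.log_inv, abs_of_nonpos (Real.log_nonpos hs.le hs1)]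
  have hsplit := Literature.MeasureTheory.Hausdorff.add_rpow_le_two_rpow_mul (mul_nonneg hm hls) hle hq.le
  rw [Real.mul_rpow hm hls] at hsplit
  have hX : s ^ γ * Real.log s⁻¹ ^ q ≤ (q / γ) ^ q := by
    rw [hls']; exact rpow_mul_abs_log_rpow_le hs hs1 hγ hq
  have hY : e ^ θ * Real.log e⁻¹ ^ q ≤ (2 * q / θ) ^ q * e ^ (θ / 2) := rpow_mul_log_inv_rpow_le he he1 hθ hq
  have heθ : e ^ θ ≤ e ^ (θ / 2) := Real.rpow_le_rpow_of_exponent_ge he he1 (by linarith)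
  have hsγ : s ^ γ ≤ 1 := Real.rpow_le_one hs.le hs1 hγ.le
  have h2q : 0 ≤ (2 : ℝ) ^ q := Real.rpow_nonneg (by norm_num) _
  have hmq : 0 ≤ m ^ q := Real.rpow_nonneg hm _
  have heθ0 : 0 ≤ e ^ θ := Real.rpow_nonneg he.le _
  have heθ20 : 0 ≤ e ^ (θ / 2) := Real.rpow_nonneg he.le _
  have hsγ0 : 0 ≤ s ^ γ := Real.rpow_nonneg hs.le _
  have hlsq : 0 ≤ Real.log s⁻¹ ^ q := Real.rpow_nonneg hls _
  have hleq : 0 ≤ Real.log e⁻¹ ^ q := Real.rpow_nonneg hle _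
  have hT1 : m ^ q * e ^ θ * (s ^ γ * Real.log s⁻¹ ^ q) ≤ m ^ q * e ^ (θ / 2) * (q / γ) ^ q :=
    mul_le_mul (mul_le_mul_of_nonneg_left heθ hmq) hX (mul_nonneg hsγ0 hlsq) (mul_nonneg hmq heθ20)
  have hT2 : s ^ γ * (e ^ θ * Real.log e⁻¹ ^ q) ≤ 1 * ((2 * q / θ) ^ q * e ^ (θ / 2)) :=
    mul_le_mul hsγ hY (mul_nonneg heθ0 hleq) zero_le_one
  calc K * e ^ θ * s ^ γ * (m * Real.log s⁻¹ + Real.log e⁻¹) ^ q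
      ≤ K * e ^ θ * s ^ γ * (2 ^ q * (m ^ q * Real.log s⁻¹ ^ q + Real.log e⁻¹ ^ q)) :=
        mul_le_mul_of_nonneg_left hsplit (mul_nonneg (mul_nonneg hK heθ0) hsγ0)
    _ = K * 2 ^ q * (m ^ q * e ^ θ * (s ^ γ * Real.log s⁻¹ ^ q) + s ^ γ * (e ^ θ * Real.log e⁻¹ ^ q)) := by ring
    _ ≤ K * 2 ^ q * (m ^ q * e ^ (θ / 2) * (q / γ) ^ q + 1 * ((2 * q / θ) ^ q * e ^ (θ / 2))) :=
        mul_le_mul_of_nonneg_left (add_le_add hT1 hT2) (mul_nonneg hK h2q)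
    _ = K * 2 ^ q * (m ^ q * (q / γ) ^ q + (2 * q / θ) ^ q) * e ^ (θ / 2) := by ring

/-- MASTER BOUND, one logarithm and a constant: `K e^θ (M₀ + log e⁻¹)^q ≤ K 2^q (M₀^q + (2q/θ)^q) · e^{θ/2}` for `0 < e ≤ 1`
(K, M₀ ≥ 0; q, θ > 0). [cite: BalabanImbrieJaffe1988, (5.9.3) p.296] -/
theorem logconst_bound {K q M₀ θ e : ℝ} (hK : 0 ≤ K) (hq : 0 < q) (hM₀ : 0 ≤ M₀) (hθ : 0 < θ)
    (he : 0 < e) (he1 : e ≤ 1) :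
    K * e ^ θ * (M₀ + Real.log e⁻¹) ^ q ≤ K * 2 ^ q * (M₀ ^ q + (2 * q / θ) ^ q) * e ^ (θ / 2) := by
  have hle : 0 ≤ Real.log e⁻¹ := Real.log_nonneg ((one_le_inv₀ he).mpr he1)
  have hsplit := Literature.MeasureTheory.Hausdorff.add_rpow_le_two_rpow_mul hM₀ hle hq.le
  have hY : e ^ θ * Real.log e⁻¹ ^ q ≤ (2 * q / θ) ^ q * e ^ (θ / 2) := rpow_mul_log_inv_rpow_le he he1 hθ hq
  have heθ : e ^ θ ≤ e ^ (θ / 2) := Real.rpow_le_rpow_of_exponent_ge he he1 (by linarith)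
  have h2q : 0 ≤ (2 : ℝ) ^ q := Real.rpow_nonneg (by norm_num) _
  have hMq : 0 ≤ M₀ ^ q := Real.rpow_nonneg hM₀ _
  have heθ0 : 0 ≤ e ^ θ := Real.rpow_nonneg he.le _
  calc K * e ^ θ * (M₀ + Real.log e⁻¹) ^ q
      ≤ K * e ^ θ * (2 ^ q * (M₀ ^ q + Real.log e⁻¹ ^ q)) := mul_le_mul_of_nonneg_left hsplit (mul_nonneg hK heθ0)
    _ = K * 2 ^ q * (M₀ ^ q * e ^ θ + e ^ θ * Real.log e⁻¹ ^ q) := by ring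
    _ ≤ K * 2 ^ q * (M₀ ^ q * e ^ (θ / 2) + (2 * q / θ) ^ q * e ^ (θ / 2)) :=
        mul_le_mul_of_nonneg_left (add_le_add (mul_le_mul_of_nonneg_left heθ hMq) hY) (mul_nonneg hK h2q)
    _ = K * 2 ^ q * (M₀ ^ q + (2 * q / θ) ^ q) * e ^ (θ / 2) := by ring

/-- the threshold: `C e^{θ/2} ≤ ½` whenever `0 < e ≤ (2C+1)^{−2/θ}` (C ≥ 0, θ > 0) — the explicit *"e ≪ 1"*.
[cite: BalabanImbrieJaffe1988, (4.1) p.273] -/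
theorem small_of_le_threshold {C θ e : ℝ} (hC : 0 ≤ C) (hθ : 0 < θ) (he : 0 < e)
    (hle : e ≤ (2 * C + 1) ^ (-(2 / θ))) : C * e ^ (θ / 2) ≤ 1 / 2 := by
  have hD : 0 < 2 * C + 1 := by linarith
  have h1 : e ^ (θ / 2) ≤ ((2 * C + 1) ^ (-(2 / θ))) ^ (θ / 2) :=
    Real.rpow_le_rpow he.le hle (by linarith)
  rw [← Real.rpow_mul hD.le, show -(2 / θ) * (θ / 2) = -1 by field_simp, Real.rpow_neg_one] at h1
  calc C * e ^ (θ / 2) ≤ C * (2 * C + 1)⁻¹ := mul_le_mul_of_nonneg_left h1 hC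
    _ ≤ 1 / 2 := by rw [← div_eq_mul_inv, div_le_iff₀ hD]; linarith

end Kernels

/-! ## §2 The printed scales (2.2), (2.33) at `s = L^kε`: `e_k = s^{(4−d)/2}e`, `λ_k = s^{4−d}λ`, `p(e_k) = |log e_k⁻¹|^p` -/

section Scales

/-- `log e_k⁻¹ = ((4−d)/2)·log s⁻¹ + log e⁻¹` for `e_k = s^{(4−d)/2}e` (s, e > 0). [cite: BalabanImbrieJaffe1988, (2.2) p.260] -/
theorem log_inv_ek {s e m : ℝ} (hs : 0 < s) (he : 0 < e) :
    Real.log (s ^ m * e)⁻¹ = m * Real.log s⁻¹ + Real.log e⁻¹ := by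
  rw [Real.log_inv, Real.log_inv, Real.log_inv, Real.log_mul (Real.rpow_pos_of_pos hs m).ne' he.ne',
    Real.log_rpow hs]
  ring

/-- `p(e_k)³ = (((4−d)/2)·log s⁻¹ + log e⁻¹)^{3p}` for `e_k = s^{(4−d)/2}e`, `0 < s ≤ 1`, `0 < e ≤ 1`, `m = (4−d)/2 ≥ 0`.
[cite: BalabanImbrieJaffe1988, (2.33) p.263] -/
theorem pLog_pow_three {s e m p : ℝ} (hs : 0 < s) (hs1 : s ≤ 1) (he : 0 < e) (he1 : e ≤ 1) (hm : 0 ≤ m) :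
    pLog p (s ^ m * e) ^ 3 = (m * Real.log s⁻¹ + Real.log e⁻¹) ^ (3 * p) := by
  have hL : 0 ≤ m * Real.log s⁻¹ + Real.log e⁻¹ :=
    add_nonneg (mul_nonneg hm (Real.log_nonneg ((one_le_inv₀ hs).mpr hs1))) (Real.log_nonneg ((one_le_inv₀ he).mpr he1))
  unfold pLog
  rw [log_inv_ek hs he, abs_of_nonneg hL, ← Real.rpow_natCast, ← Real.rpow_mul hL]
  norm_num
  ring_nf

/-- `λ_k^{−1/4} = λ^{−1/4}·s^{−(4−d)/4}` for `λ_k = s^{4−d}λ` (written with `4−d = 2m`: `(s^{2m}λ)^{−1/4} = λ^{−1/4}s^{−m/2}`).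
[cite: BalabanImbrieJaffe1988, (2.2) p.260] -/
theorem lamk_rpow_neg_quarter_eq {s lam m : ℝ} (hs : 0 < s) (hlam : 0 ≤ lam) :
    (s ^ (2 * m) * lam) ^ (-(1 / 4 : ℝ)) = lam ^ (-(1 / 4 : ℝ)) * s ^ (-(m / 2)) := by
  rw [Real.mul_rpow (Real.rpow_nonneg hs.le _) hlam, ← Real.rpow_mul hs.le, mul_comm]
  congr 1
  ring_nf

end Scales

/-! ## §3 The printed stopping scale (4.1) p.273 `ε₀ = min{1,(8λ/e²)^{1/2}}e^β` and the vertex factor `e^β(L^kε/ε₀)^{1/4−α}` -/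

section StoppingScale

/-- p. 273 [PDF 17] *"we assume that L^kε < ε₀ = min{1, (8λ/e²)^{1/2}}e^β, with β > 0 small and e ≪ 1"* — the printed stopping
scale (r18's `BIJ88Sect4Statements.eps0`) is positive for `λ, e > 0`. [cite: BalabanImbrieJaffe1988, (4.1) p.273] -/
theorem eps0_pos {lam e : ℝ} (hlam : 0 < lam) (he : 0 < e) (β : ℝ) : 0 < BIJ88Sect4Statements.eps0 lam e β := by
  unfold BIJ88Sect4Statements.eps0
  exact mul_pos (lt_min one_pos (Real.sqrt_pos.2 (div_pos (by linarith) (pow_pos he 2)))) (Real.rpow_pos_of_pos he _)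

/-- … and `ε₀ = min{1,(8λ/e²)^{1/2}}e^β ≤ e^β` (e = the charge, read as in `BIJ88Sect4Statements.eps0`; GAPS G-C2-p36-04): the vertex
factor `e^β(L^kε/ε₀)^{1/4−α}` is at least a pure power of the charge times `(L^kε)^{1/4−α}` (`vertex_lower`). [cite: BalabanImbrieJaffe1988, (4.1) p.273] -/
theorem eps0_le_rpow {lam e : ℝ} (he : 0 < e) (β : ℝ) : BIJ88Sect4Statements.eps0 lam e β ≤ e ^ β := by
  unfold BIJ88Sect4Statements.eps0
  calc min 1 (Real.sqrt (8 * lam / e ^ 2)) * e ^ β ≤ 1 * e ^ β :=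
      mul_le_mul_of_nonneg_right (min_le_left _ _) (Real.rpow_nonneg he.le _)
    _ = e ^ β := one_mul _

/-- the vertex factor from below: `e^{β(3/4+α)}·s^{1/4−α} ≤ e^β(s/ε₀)^{1/4−α}` whenever `0 < ε₀ ≤ e^β` and `α ≤ ¼` (s = L^kε) — with
the printed `ε₀ ≤ e^β` the factor `ε₀^{−(1/4−α)}` only helps. [cite: BalabanImbrieJaffe1988, (4.1) p.273] -/
theorem vertex_lower {e s ε₀ α β : ℝ} (he : 0 < e) (hs : 0 < s) (hε₀ : 0 < ε₀) (hε₀e : ε₀ ≤ e ^ β) (hα4 : α ≤ 1 / 4) :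
    e ^ (β * (3 / 4 + α)) * s ^ (1 / 4 - α) ≤ e ^ β * (s / ε₀) ^ (1 / 4 - α) := by
  have hx0 : 0 ≤ 1 / 4 - α := by linarith
  have hε₀x : 0 < ε₀ ^ (1 / 4 - α) := Real.rpow_pos_of_pos hε₀ _
  have h1 : ε₀ ^ (1 / 4 - α) ≤ (e ^ β) ^ (1 / 4 - α) := Real.rpow_le_rpow hε₀.le hε₀e hx0
  rw [← Real.rpow_mul he.le] at h1
  have h2 : e ^ (β * (3 / 4 + α)) * ε₀ ^ (1 / 4 - α) ≤ e ^ β :=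
    calc e ^ (β * (3 / 4 + α)) * ε₀ ^ (1 / 4 - α) ≤ e ^ (β * (3 / 4 + α)) * e ^ (β * (1 / 4 - α)) :=
        mul_le_mul_of_nonneg_left h1 (Real.rpow_nonneg he.le _)
      _ = e ^ β := by rw [← Real.rpow_add he]; ring_nf
  have h3 : e ^ (β * (3 / 4 + α)) ≤ e ^ β / ε₀ ^ (1 / 4 - α) := (le_div_iff₀ hε₀x).2 h2
  calc e ^ (β * (3 / 4 + α)) * s ^ (1 / 4 - α) ≤ e ^ β / ε₀ ^ (1 / 4 - α) * s ^ (1 / 4 - α) :=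
      mul_le_mul_of_nonneg_right h3 (Real.rpow_nonneg hs.le _)
    _ = e ^ β * (s / ε₀) ^ (1 / 4 - α) := by rw [Real.div_rpow hs.le hε₀.le]; ring

/-- the vertex factor is `≤ 1` inside the induction (`L^kε ≤ ε₀`, p. 273) for `0 < e ≤ 1`, `β ≥ 0`, `α ≤ ¼`. [cite: BalabanImbrieJaffe1988, (4.1) p.273] -/
theorem vertex_le_one {e s ε₀ α β : ℝ} (he : 0 < e) (he1 : e ≤ 1) (hβ0 : 0 ≤ β) (hs : 0 < s) (hsε₀ : s ≤ ε₀) (hα4 : α ≤ 1 / 4) :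
    e ^ β * (s / ε₀) ^ (1 / 4 - α) ≤ 1 := by
  have hε₀ : 0 < ε₀ := hs.trans_le hsε₀
  have h1 : e ^ β ≤ 1 := Real.rpow_le_one he.le he1 hβ0
  have h2 : (s / ε₀) ^ (1 / 4 - α) ≤ 1 :=
    Real.rpow_le_one (div_nonneg hs.le hε₀.le) ((div_le_one hε₀).2 hsε₀) (by linarith)
  calc e ^ β * (s / ε₀) ^ (1 / 4 - α) ≤ 1 * 1 :=
      mul_le_mul h1 h2 (Real.rpow_nonneg (div_nonneg hs.le hε₀.le) _) zero_le_one
    _ = 1 := one_mul _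

/-- `p(e_k) ≥ 1` as soon as `e_k ≤ 1/e` (Euler) — in particular for `e ≤ 1/e`, since `e_k = (L^kε)^{(4−d)/2}e ≤ e`.
[cite: BalabanImbrieJaffe1988, (2.33) p.263] -/
theorem one_le_pLog {p ek : ℝ} (hp : 0 ≤ p) (hek : 0 < ek) (hek1 : ek ≤ Real.exp (-1)) : 1 ≤ pLog p ek := by
  unfold pLog
  have h1 : Real.log ek ≤ -1 := by
    have := Real.log_le_log hek hek1
    rwa [Real.log_exp] at this
  have h2 : 1 ≤ |Real.log ek⁻¹| := by
    rw [Real.log_inv]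
    exact le_trans (by linarith) (le_abs_self _)
  exact Real.one_le_rpow h2 hp

end StoppingScale

end Literature.MathematicalPhysics.QuantumFieldTheory.BalabanImbrieJaffe1984to88.BIJ88ChargePowerLogScale
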